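import Summits.AtomisticToContinuum.FouriersLaw.Theorems.BondHeatUncertaintyBoundedResponseBathHeatForecast
import HarnessLib

/-!
# BondHeatUncertainty / BoundedResponse — «BathHeat» ADDENDUM §7: the PARITY form of the kernel floor
(decomp-a2c lens-1, g107, NODE 107 addendum, second file; blocker item stmt-AtomisticToContinuum-11071 = `BoundedResponse`)

Imports the §6 file `…BathHeatForecast` (`bathFcastSq`, (FCᶜ) `BathForecastCeiling`, the envelope `abs_bathKinCorr_two_mul_le_bathFcastSq`, `rpow_half_neg`)
and through it NODE 107 (`bathKinCorr`, (BKᶠ) `BathKernelFloor`, `boundedResponse_of_subdiffusiveBondHeat_bathKernelFloor`) and the PhononMeanFreePath echo file;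
uses the tree's flip invariance `…Cruxes.SuperadditiveResistance.FloatingProbeBypassLaplacian.integral_flip_gibbsMeasure / integrable_flip_gibbsMeasure`.

CONTENT.  `bathFcastOddSq` `Odd_N(t) := ¼∫(G_t − G_t∘Θ)² dμ_T` (squared norm of the `Θ`-ODD part of the forecast `G_t = P_t(p₀²)`, `Θ(q,p) = (q,−p)`);
Props (OFᶜ_{p,α}) `BathOddForecastCeiling` (`Odd_N(t) ≤ A·N^p·t^{−α}`) and (PDᶠ_{p,α}) `BathParityDominance` (`2·Odd_N(t) − F_N(t) = ‖(P_tθ)⁻‖² − ‖(P_tθ)⁺‖²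
≤ A·N^p·t^{−α}`).  Theorems: ★★ EXACT parity split `bathKinCorr_two_mul_eq_fcast_sub_odd` **`K_N(2t) = F_N(t) − 2·Odd_N(t)`** (`N ≥ 2`, `t ≥ 0`;
echo identity + `⟨g∘Θ, g⟩ = ‖g‖² − ½‖g − g∘Θ‖²`); `bathFcastOddSq_nonneg`, `bathFcastOddSq_le_bathFcastSq`, `neg_bathFcastOddSq_le_bathKinCorr` (`K_N(2t) ≥
−Odd_N(t)`); `bathOddForecastCeiling_of_bathForecastCeiling` (FCᶜ ⟹ OFᶜ); ★ `bathKernelFloor_of_bathOddForecastCeiling` **(OFᶜ_{p,α}) ⟹ (BKᶠ_{p,α})**;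
`boundedResponse_of_subdiffusiveBondHeat_bathOddForecastCeiling` ((S) ∧ OFᶜ_{0,3/2} ⟹ 11071); ★★ `bathKernelFloor_iff_bathParityDominance`
**(BKᶠ_{p,α}) ⟺ (PDᶠ_{p,α})** (EQUIV, constants `2^{∓α}`); `bathParityDominance_of_bathOddForecastCeiling`; ★★
`boundedResponse_of_subdiffusiveBondHeat_bathParityDominance` **(S) ∧ (PDᶠ_{0,3/2}) ⟹ 11071**.

READING.  The (S)-side door of record (BKᶠ_{0,3/2}) says exactly: the `Θ`-ODD (current-type) content of the boundary energy forecast never exceeds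
its `Θ`-EVEN (energy-type) content by more than `A t^{−3/2}`, uniformly in `N` — a DOMINANCE statement between the two parity sectors of ONE forecast
(harmonic chain: `A = 0` by AM–GM on the square of a linear functional; diffusive regime: both sides `≲ t^{−3/2}`), the odd/even axis of NODE 102 for the
one-site observable `θ = p₀² − T`.  The SMALLNESS statements (FCᶜ)/(OFᶜ) are phonon-FALSE (§6 calibration: `Odd_N ≈ F_N/2 → T²η₀² > 0`) and only
diffusive-true-leaning (mean-free-path class).
Tags: (PDᶠ_{0,3/2}) = (BKᶠ_{0,3/2}) EQUIV · INCOMPARABLE with 11071 (MustFailF M14) · UNDECIDED · TRUE-leaning · IDEA-NEEDED; (OFᶜ_{0,3/2}) WEAKER than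
(FCᶜ_{0,3/2}), stronger than (PDᶠ) as far as the tree knows (M15) · INCOMPARABLE with 11071 (M11) · UNDECIDED · diffusive-TRUE-leaning · phonon-FALSE ·
IDEA-NEEDED.  No `sorry`; standard axioms; nothing here closes an item (3 def-like + 11 theorems).
-/

noncomputable section

open MeasureTheory ProbabilityTheory Filter Topology Set Function
open scoped NNReal ENNReal
open Literature.MathematicalPhysics.KineticTheory.HeatConduction
open Literature.MathematicalPhysics.KineticTheory OscillatorChain
open Literature.Probability.Process
open Summit.AtomisticToContinuum.FouriersLaw.Theorems.SubdiffusiveBondHeat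
open Summit.AtomisticToContinuum.FouriersLaw.Theorems.SubdiffusiveBondHeat.EscapeGrading
open Summit.AtomisticToContinuum.FouriersLaw.Theorems.OddSectorIrreversibility

namespace Summit.AtomisticToContinuum.FouriersLaw.Theorems.BoundedResponse.HeatSpreading

open Summit.AtomisticToContinuum.FouriersLaw.Theorems.BoundedResponse.TransientContact
open Summit.AtomisticToContinuum.FouriersLaw.Theorems.BoundedResponse.ParityFloor (extensiveBlockEnergyVariance_holds)
open Summit.AtomisticToContinuum.FouriersLaw.Theses.BondHeatUncertainty (BoundedResponse SubdiffusiveBondHeat)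
/-! ## §7 The PARITY form: `K_N(2t) = F_N(t) − 2·Odd_N(t)` EXACTLY; the kernel FLOOR ⟺ «the `Θ`-odd forecast never outweighs the `Θ`-even one»

With `G_t(z) := ∫ p₀² dP_t(z,·)` and the momentum flip `Θ(q,p) = (q,−p)` (`μ_T`-preserving): the echo identity reads `K_N(2t) = ⟨(G_t − T)∘Θ, G_t − T⟩_{μ_T}
= ‖(G_t−T)⁺‖² − ‖(G_t−T)⁻‖²` (`Θ`-even/odd parts), i.e. `K_N(2t) = F_N(t) − 2·Odd_N(t)` with `Odd_N(t) := ‖(G_t − T)⁻‖² = ¼∫(G_t − G_t∘Θ)² dμ_T`.  Hence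
(i) `K_N(2t) ≥ −Odd_N(t)`, so a CEILING (OFᶜ) on the `Θ`-odd part alone gives (BKᶠ) — but (OFᶜ) is phonon-FALSE like (FCᶜ) (harmonic chain:
`Odd_N = 4T²ab ≈ F_N/2 = O(1)`, §6 calibration), a mean-free-path-class statement; and (ii) the EXACT EQUIVALENCE (PDᶠ_{p,α}) ⟺ (BKᶠ_{p,α}) with the
PARITY-DOMINANCE floor (PDᶠ) «`‖(P_tθ)⁻‖² − ‖(P_tθ)⁺‖² = 2·Odd_N(t) − F_N(t) ≤ A·N^p·t^{−α}`»: the `Θ`-ODD (current-type) content of the boundary energy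
forecast never exceeds its `Θ`-EVEN (energy-type) content by more than `A t^{−α}` — harmonic: holds with `A = 0` (AM–GM on the square of a linear
functional); diffusive: both sides `≲ t^{−3/2}`.  This is the honest parity reading of the (S)-side door of record (BKᶠ_{0,3/2}): a DOMINANCE statement
between the two parity sectors of ONE forecast, the odd/even axis of NODE 102 for the one-site observable `θ`.
-/

/-- **`Θ`-odd part (squared `L²(μ_T)` norm) of the boundary energy forecast**: `Odd_N(t) := ¼ ∫ (G_t(z) − G_t(q,−p))² dμ_T(z)`,
`G_t(z) = ∫ p₀² dP_t(z,·)` (`N ≥ 1`; `0` for `N = 0`). [formal bookkeeping] -/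
def bathFcastOddSq (ω₂ lam β γ T : ℝ) (N : ℕ) (t : ℝ) : ℝ :=
  if h : 0 < N then
    (1 / 4) * ∫ z, ((∫ y, (y.2 ⟨0, h⟩) ^ 2 ∂((pinnedChain ω₂ lam β γ).transitionKernel N T T t.toNNReal z)) -
        (∫ y, (y.2 ⟨0, h⟩) ^ 2 ∂((pinnedChain ω₂ lam β γ).transitionKernel N T T t.toNNReal (z.1, -z.2)))) ^ 2
      ∂((pinnedChain ω₂ lam β γ).gibbsMeasure N T)
  else 0

/-- **(OFᶜ_{p,α}) `BathOddForecastCeiling p α`** — N-uniform algebraic decay of the `Θ`-ODD part of the boundary energy forecast: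
`∃ A, t₀ > 0, N₀: ∀ N ≥ N₀ ∀ t ≥ t₀, Odd_N(t) ≤ A·N^p·t^{−α}`.  WEAKER than (FCᶜ_{p,α}) (`Odd_N ≤ F_N`); at `(0,3/2)` sufficient for (BKᶠ_{0,3/2}),
hence with (S) for 11071.  Diffusive-regime heuristic `Odd_N(t) ≍ t^{−5/2}` (odd content = currents, one gradient below the even energy profile);
phonon-FALSE (harmonic chain: `Odd_N ≈ F_N/2 → T²η₀² > 0`, §6 calibration).  Tag: INCOMPARABLE with 11071 · UNDECIDED · diffusive-TRUE-leaning ·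
phonon-FALSE · IDEA-NEEDED (mean-free-path class). [route statement · this cell; NOT a literature fact] -/
def BathOddForecastCeiling (p α : ℝ) : Prop :=
  ∀ ω₂ lam β γ : ℝ, 0 < ω₂ → 0 < lam → 0 < β → 0 < γ → ∀ T : ℝ, 0 < T →
    ∃ A t₀ : ℝ, 0 < t₀ ∧ ∃ N₀ : ℕ, ∀ N : ℕ, N₀ ≤ N → ∀ t : ℝ, t₀ ≤ t →
      bathFcastOddSq ω₂ lam β γ T N t ≤ A * (N : ℝ) ^ p * t ^ (-α)

/-- **(PDᶠ_{p,α}) `BathParityDominance p α`** — PARITY-DOMINANCE floor: `∃ A, t₀ > 0, N₀: ∀ N ≥ N₀ ∀ t ≥ t₀,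
2·Odd_N(t) − F_N(t) = ‖(P_tθ)⁻‖² − ‖(P_tθ)⁺‖² ≤ A·N^p·t^{−α}` — the `Θ`-odd content of the boundary energy forecast exceeds the `Θ`-even content by at
most `A t^{−α}`.  EQUIV to (BKᶠ_{p,α}) (`bathKernelFloor_iff_bathParityDominance`, constants `2^{±α}`, thresholds `r₀ = 2t₀`); harmonic chain: holds
with `A = 0`.  Tag: = (BKᶠ) · INCOMPARABLE with 11071 · UNDECIDED · TRUE-leaning (phonon-TRUE, diffusive-TRUE-leaning) · IDEA-NEEDED.
[route statement · this cell; NOT a literature fact] -/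
def BathParityDominance (p α : ℝ) : Prop :=
  ∀ ω₂ lam β γ : ℝ, 0 < ω₂ → 0 < lam → 0 < β → 0 < γ → ∀ T : ℝ, 0 < T →
    ∃ A t₀ : ℝ, 0 < t₀ ∧ ∃ N₀ : ℕ, ∀ N : ℕ, N₀ ≤ N → ∀ t : ℝ, t₀ ≤ t →
      2 * bathFcastOddSq ω₂ lam β γ T N t - bathFcastSq ω₂ lam β γ T N t ≤ A * (N : ℝ) ^ p * t ^ (-α)

section ParityDoor

variable {ω₂ lam β γ : ℝ} (hω : 0 < ω₂) (hl : 0 < lam) (hβ : 0 < β) (hγ : 0 < γ) {T : ℝ} (hT : 0 < T)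
include hω hl hβ hγ hT

/-- ★★ **PARITY SPLIT (exact)**: `K_N(2t) = F_N(t) − 2·Odd_N(t)` (`N ≥ 2`, `t ≥ 0`) — the echo identity `K_N(2t) = ⟨(G_t−T)∘Θ, G_t−T⟩` plus
`⟨g∘Θ, g⟩ = ‖g‖² − ½‖g − g∘Θ‖²` (`Θ` preserves `μ_T`). [this cell] -/
theorem bathKinCorr_two_mul_eq_fcast_sub_odd {N : ℕ} (hN : 2 ≤ N) {t : ℝ} (ht : 0 ≤ t) :
    bathKinCorr ω₂ lam β γ T N (2 * t) = bathFcastSq ω₂ lam β γ T N t - 2 * bathFcastOddSq ω₂ lam β γ T N t := by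
  obtain ⟨n, rfl⟩ : ∃ n, N = n + 1 := ⟨N - 1, by omega⟩
  set μ := (pinnedChain ω₂ lam β γ).gibbsMeasure (n + 1) T with hμ
  set G : PhaseSpace (n + 1) → ℝ := fun z =>
    ∫ y, (y.2 0) ^ 2 ∂((pinnedChain ω₂ lam β γ).transitionKernel (n + 1) T T t.toNNReal z) with hG
  have hecho := PhononMeanFreePath.endKineticAutocov_timeReversal ω₂ lam β γ hω hl hβ hγ T hT n (by omega) t t ht ht
  rw [← two_mul] at hecho
  -- measurability / integrability of the forecast, its flip, their squares and products
  have hGm : Measurable G := by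
    have h : StronglyMeasurable fun y : PhaseSpace (n + 1) => y.2 0 ^ 2 :=
      (by fun_prop : Measurable fun y : PhaseSpace (n + 1) => y.2 0 ^ 2).stronglyMeasurable
    exact (h.integral_kernel (κ := (pinnedChain ω₂ lam β γ).transitionKernel (n + 1) T T t.toNNReal)).measurable
  have hflipm : Measurable fun z : PhaseSpace (n + 1) => ((z.1, -z.2) : PhaseSpace (n + 1)) := by fun_prop
  have hGΘm : Measurable fun z : PhaseSpace (n + 1) => G (z.1, -z.2) := hGm.comp hflipm
  have ha2 : Integrable (fun z => (G z - T) ^ 2) μ :=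
    PhononMeanFreePath.kinAutocov_integrable_sq_kinFcast hω hT hl hβ hγ n t.toNNReal
  have hb2 : Integrable (fun z => (G (z.1, -z.2) - T) ^ 2) μ :=
    Summit.AtomisticToContinuum.FouriersLaw.Cruxes.SuperadditiveResistance.FloatingProbeBypassLaplacian.integrable_flip_gibbsMeasure
      (pinnedChain ω₂ lam β γ) (n + 1) T (F := fun z => (G z - T) ^ 2) ha2
  have hb2eq : ∫ z, (G (z.1, -z.2) - T) ^ 2 ∂μ = ∫ z, (G z - T) ^ 2 ∂μ :=
    Summit.AtomisticToContinuum.FouriersLaw.Cruxes.SuperadditiveResistance.FloatingProbeBypassLaplacian.integral_flip_gibbsMeasure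
      (pinnedChain ω₂ lam β γ) (n + 1) T (fun z => (G z - T) ^ 2)
  have hbound : Integrable (fun z => 2 * (G z - T) ^ 2 + 2 * (G (z.1, -z.2) - T) ^ 2) μ :=
    (ha2.const_mul 2).add (hb2.const_mul 2)
  have hd2 : Integrable (fun z => (G z - G (z.1, -z.2)) ^ 2) μ := by
    refine Integrable.mono' hbound ((hGm.sub hGΘm).pow_const 2).aestronglyMeasurable ?_
    filter_upwards with z
    rw [Real.norm_eq_abs, abs_of_nonneg (sq_nonneg _)]
    nlinarith [sq_nonneg (G z - T + (G (z.1, -z.2) - T))]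
  have hB : Integrable (fun z => 1 / 2 * (G z - G (z.1, -z.2)) ^ 2) μ := hd2.const_mul (1 / 2)
  have hC : Integrable (fun z => 1 / 2 * ((G (z.1, -z.2) - T) ^ 2 - (G z - T) ^ 2)) μ := (hb2.sub ha2).const_mul (1 / 2)
  have hA : Integrable (fun z => (G z - T) ^ 2 - 1 / 2 * (G z - G (z.1, -z.2)) ^ 2) μ := ha2.sub hB
  have key : ∫ z, (G (z.1, -z.2) - T) * (G z - T) ∂μ =
      (∫ z, (G z - T) ^ 2 ∂μ) - 2 * ((1 / 4) * ∫ z, (G z - G (z.1, -z.2)) ^ 2 ∂μ) := by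
    have h1 : ∫ z, (G (z.1, -z.2) - T) * (G z - T) ∂μ =
        ∫ z, ((G z - T) ^ 2 - 1 / 2 * (G z - G (z.1, -z.2)) ^ 2) + 1 / 2 * ((G (z.1, -z.2) - T) ^ 2 - (G z - T) ^ 2) ∂μ :=
      integral_congr_ae (Eventually.of_forall fun z => by ring)
    rw [h1, integral_add hA hC, integral_sub ha2 hB, integral_const_mul, integral_const_mul, integral_sub hb2 ha2, hb2eq]
    ring
  unfold bathKinCorr bathFcastSq bathFcastOddSq
  rw [dif_pos (Nat.succ_pos n), dif_pos (Nat.succ_pos n), dif_pos (Nat.succ_pos n)]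
  exact hecho.trans key

omit hω hl hβ hγ hT in
/-- `Odd_N(t) ≥ 0`. [formal bookkeeping] -/
theorem bathFcastOddSq_nonneg (N : ℕ) (t : ℝ) : 0 ≤ bathFcastOddSq ω₂ lam β γ T N t := by
  unfold bathFcastOddSq
  split_ifs with h
  · exact mul_nonneg (by norm_num) (integral_nonneg fun z => sq_nonneg _)
  · exact le_rfl

/-- `Odd_N(t) ≤ F_N(t)` (`N ≥ 2`, `t ≥ 0`): from the parity split and the envelope `|K_N(2t)| ≤ F_N(t)`. [formal bookkeeping] -/
theorem bathFcastOddSq_le_bathFcastSq {N : ℕ} (hN : 2 ≤ N) {t : ℝ} (ht : 0 ≤ t) :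
    bathFcastOddSq ω₂ lam β γ T N t ≤ bathFcastSq ω₂ lam β γ T N t := by
  have h1 := bathKinCorr_two_mul_eq_fcast_sub_odd hω hl hβ hγ hT hN ht
  have h2 := (abs_le.1 (abs_bathKinCorr_two_mul_le_bathFcastSq hω hl hβ hγ hT hN ht)).1
  linarith

/-- ★ **One-sided floor from the odd part alone**: `K_N(2t) ≥ −Odd_N(t)` (`N ≥ 2`, `t ≥ 0`). [this cell] -/
theorem neg_bathFcastOddSq_le_bathKinCorr {N : ℕ} (hN : 2 ≤ N) {t : ℝ} (ht : 0 ≤ t) :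
    -bathFcastOddSq ω₂ lam β γ T N t ≤ bathKinCorr ω₂ lam β γ T N (2 * t) := by
  have h1 := bathKinCorr_two_mul_eq_fcast_sub_odd hω hl hβ hγ hT hN ht
  have h2 := bathFcastOddSq_le_bathFcastSq hω hl hβ hγ hT hN ht
  linarith

end ParityDoor

section ParityConsequences

/-- (FCᶜ_{p,α}) ⟹ (OFᶜ_{p,α}) (`Odd_N ≤ F_N`). [formal bookkeeping] -/
theorem bathOddForecastCeiling_of_bathForecastCeiling {p α : ℝ} (hF : BathForecastCeiling p α) : BathOddForecastCeiling p α := by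
  intro ω₂ lam β γ hω hl hβ hγ T hT
  obtain ⟨A, t₀, ht₀, N₀, hA⟩ := hF ω₂ lam β γ hω hl hβ hγ T hT
  refine ⟨A, t₀, ht₀, max N₀ 2, fun N hN t hts => ?_⟩
  exact le_trans (bathFcastOddSq_le_bathFcastSq hω hl hβ hγ hT (le_trans (le_max_right _ _) hN) (le_trans ht₀.le hts))
    (hA N (le_trans (le_max_left _ _) hN) t hts)

/-- ★★ **(OFᶜ_{p,α}) ⟹ (BKᶠ_{p,α})**: a ceiling on the `Θ`-odd forecast gives the one-sided kernel floor past `2t₀` (constant `2^α·max(A,0)`). [this cell] -/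
theorem bathKernelFloor_of_bathOddForecastCeiling {p α : ℝ} (hO : BathOddForecastCeiling p α) : BathKernelFloor p α := by
  intro ω₂ lam β γ hω hl hβ hγ T hT
  obtain ⟨A, t₀, ht₀, N₀, hA⟩ := hO ω₂ lam β γ hω hl hβ hγ T hT
  refine ⟨(2 : ℝ) ^ α * max A 0, 2 * t₀, by positivity, max N₀ 2, fun N hN r hr => ?_⟩
  have hNN₀ : N₀ ≤ N := le_trans (le_max_left _ _) hN
  have hN2 : 2 ≤ N := le_trans (le_max_right _ _) hN
  have hr : 0 < r := by linarith
  have hNpos : (0 : ℝ) < N := by exact_mod_cast (show 0 < N by omega)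
  have h1 := neg_bathFcastOddSq_le_bathKinCorr hω hl hβ hγ hT hN2 (t := r / 2) (by positivity)
  rw [show 2 * (r / 2) = r by ring] at h1
  have h2 := hA N hNN₀ (r / 2) (by linarith)
  rw [rpow_half_neg hr] at h2
  have hNp : 0 ≤ (N : ℝ) ^ p := Real.rpow_nonneg hNpos.le p
  have hrα : 0 ≤ r ^ (-α) := Real.rpow_nonneg hr.le _
  have h2α : 0 ≤ (2 : ℝ) ^ α := Real.rpow_nonneg (by norm_num) _
  have h3 : A * (N : ℝ) ^ p * ((2 : ℝ) ^ α * r ^ (-α)) ≤ max A 0 * (N : ℝ) ^ p * ((2 : ℝ) ^ α * r ^ (-α)) :=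
    mul_le_mul_of_nonneg_right (mul_le_mul_of_nonneg_right (le_max_left _ _) hNp) (mul_nonneg h2α hrα)
  have h4 : (2 : ℝ) ^ α * max A 0 * (N : ℝ) ^ p * r ^ (-α) = max A 0 * (N : ℝ) ^ p * ((2 : ℝ) ^ α * r ^ (-α)) := by ring
  rw [h4]
  linarith

/-- ★★ **(S) ∧ (OFᶜ_{0,3/2}) ⟹ 11071** — the (S)-door in parity currency: beneath (S) the blocker follows from the N-uniform diffusive decay of the
`Θ`-ODD part of ONE boundary forecast. [this cell] -/
theorem boundedResponse_of_subdiffusiveBondHeat_bathOddForecastCeiling (hS : SubdiffusiveBondHeat)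
    (hO : BathOddForecastCeiling 0 (3 / 2)) : BoundedResponse :=
  boundedResponse_of_subdiffusiveBondHeat_bathKernelFloor hS (bathKernelFloor_of_bathOddForecastCeiling hO)

/-- `(2·t)^(−α) = 2^(−α)·t^(−α)` for `t ≥ 0`. [formal bookkeeping] -/
theorem rpow_two_mul_neg {t α : ℝ} (ht : 0 ≤ t) : (2 * t) ^ (-α) = (2 : ℝ) ^ (-α) * t ^ (-α) :=
  Real.mul_rpow (by norm_num) ht

/-- ★★ **(BKᶠ_{p,α}) ⟺ (PDᶠ_{p,α})**: the one-sided kernel floor IS the parity-dominance floor of the boundary energy forecast (exact split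
`K_N(2t) = F_N(t) − 2·Odd_N(t)`; constants `2^{∓α}`, thresholds `t₀ = r₀/2`, `r₀ = 2t₀`, `N₀ ↦ max N₀ 2`). [this cell] -/
theorem bathKernelFloor_iff_bathParityDominance {p α : ℝ} : BathKernelFloor p α ↔ BathParityDominance p α := by
  constructor
  · intro hK ω₂ lam β γ hω hl hβ hγ T hT
    obtain ⟨A, r₀, hr₀, N₀, hA⟩ := hK ω₂ lam β γ hω hl hβ hγ T hT
    refine ⟨(2 : ℝ) ^ (-α) * max A 0, r₀ / 2, by positivity, max N₀ 2, fun N hN t ht => ?_⟩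
    have hNN₀ : N₀ ≤ N := le_trans (le_max_left _ _) hN
    have hN2 : 2 ≤ N := le_trans (le_max_right _ _) hN
    have ht0 : 0 ≤ t := by linarith
    have hNpos : (0 : ℝ) < N := by exact_mod_cast (show 0 < N by omega)
    have h1 := bathKinCorr_two_mul_eq_fcast_sub_odd hω hl hβ hγ hT hN2 ht0
    have h2 := hA N hNN₀ (2 * t) (by linarith)
    rw [rpow_two_mul_neg ht0] at h2
    have hNp : 0 ≤ (N : ℝ) ^ p := Real.rpow_nonneg hNpos.le p
    have htα : 0 ≤ t ^ (-α) := Real.rpow_nonneg ht0 _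
    have h2α : 0 ≤ (2 : ℝ) ^ (-α) := Real.rpow_nonneg (by norm_num) _
    have h3 : A * (N : ℝ) ^ p * ((2 : ℝ) ^ (-α) * t ^ (-α)) ≤ max A 0 * (N : ℝ) ^ p * ((2 : ℝ) ^ (-α) * t ^ (-α)) :=
      mul_le_mul_of_nonneg_right (mul_le_mul_of_nonneg_right (le_max_left _ _) hNp) (mul_nonneg h2α htα)
    have h4 : (2 : ℝ) ^ (-α) * max A 0 * (N : ℝ) ^ p * t ^ (-α) = max A 0 * (N : ℝ) ^ p * ((2 : ℝ) ^ (-α) * t ^ (-α)) := by ring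
    rw [h4]
    linarith
  · intro hP ω₂ lam β γ hω hl hβ hγ T hT
    obtain ⟨A, t₀, ht₀, N₀, hA⟩ := hP ω₂ lam β γ hω hl hβ hγ T hT
    refine ⟨(2 : ℝ) ^ α * max A 0, 2 * t₀, by positivity, max N₀ 2, fun N hN r hr => ?_⟩
    have hNN₀ : N₀ ≤ N := le_trans (le_max_left _ _) hN
    have hN2 : 2 ≤ N := le_trans (le_max_right _ _) hN
    have hr0 : 0 < r := by linarith
    have hNpos : (0 : ℝ) < N := by exact_mod_cast (show 0 < N by omega)
    have h1 := bathKinCorr_two_mul_eq_fcast_sub_odd hω hl hβ hγ hT hN2 (t := r / 2) (by positivity)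
    rw [show 2 * (r / 2) = r by ring] at h1
    have h2 := hA N hNN₀ (r / 2) (by linarith)
    rw [rpow_half_neg hr0] at h2
    have hNp : 0 ≤ (N : ℝ) ^ p := Real.rpow_nonneg hNpos.le p
    have hrα : 0 ≤ r ^ (-α) := Real.rpow_nonneg hr0.le _
    have h2α : 0 ≤ (2 : ℝ) ^ α := Real.rpow_nonneg (by norm_num) _
    have h3 : A * (N : ℝ) ^ p * ((2 : ℝ) ^ α * r ^ (-α)) ≤ max A 0 * (N : ℝ) ^ p * ((2 : ℝ) ^ α * r ^ (-α)) :=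
      mul_le_mul_of_nonneg_right (mul_le_mul_of_nonneg_right (le_max_left _ _) hNp) (mul_nonneg h2α hrα)
    have h4 : (2 : ℝ) ^ α * max A 0 * (N : ℝ) ^ p * r ^ (-α) = max A 0 * (N : ℝ) ^ p * ((2 : ℝ) ^ α * r ^ (-α)) := by ring
    rw [h4]
    linarith

/-- (OFᶜ_{p,α}) ⟹ (PDᶠ_{p,α}) (`2·Odd − F ≤ Odd` as `Odd ≤ F`). [formal bookkeeping] -/
theorem bathParityDominance_of_bathOddForecastCeiling {p α : ℝ} (hO : BathOddForecastCeiling p α) : BathParityDominance p α := by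
  intro ω₂ lam β γ hω hl hβ hγ T hT
  obtain ⟨A, t₀, ht₀, N₀, hA⟩ := hO ω₂ lam β γ hω hl hβ hγ T hT
  refine ⟨A, t₀, ht₀, max N₀ 2, fun N hN t hts => ?_⟩
  have h1 := bathFcastOddSq_le_bathFcastSq hω hl hβ hγ hT (le_trans (le_max_right _ _) hN) (le_trans ht₀.le hts)
  have h2 := hA N (le_trans (le_max_left _ _) hN) t hts
  linarith

/-- ★★ **(S) ∧ (PDᶠ_{0,3/2}) ⟹ 11071** — the (S)-door of record (§5) in its parity form: beneath (S) the blocker follows from «the `Θ`-odd content of the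
boundary energy forecast never outweighs its `Θ`-even content by more than `A t^{−3/2}`, uniformly in `N`». [this cell] -/
theorem boundedResponse_of_subdiffusiveBondHeat_bathParityDominance (hS : SubdiffusiveBondHeat)
    (hP : BathParityDominance 0 (3 / 2)) : BoundedResponse :=
  boundedResponse_of_subdiffusiveBondHeat_bathKernelFloor hS (bathKernelFloor_iff_bathParityDominance.2 hP)

end ParityConsequences

end Summit.AtomisticToContinuum.FouriersLaw.Theorems.BoundedResponse.HeatSpreading

end
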